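import Literature.NumberTheory.LFunctions.RudnickSarnakPairing
import Literature.NumberTheory.LFunctions.RudnickSarnakCubeDensity
import HarnessLib

/-!
# The density identity on a stratum: pairing side equals GUE side

Rudnick–Sarnak, Duke Math. J. **81** (1996), Props. 4.1 and 4.3: on the stratum `H_G` of a set
partition `G`, the sieved pairing density `∑_{(Q,b) → G} μ(O, Q) ∏ |block sums|` (Prop. 4.1 /
(4.23)–(4.26)) and the density of the Fourier transform of the GUE determinant
`∑_{σ : orbits = G} sign σ ∏_C (1 - V_{σ,C})₊` (Prop. 4.3 / (4.27)–(4.30)) coincide for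
`∑ |u_j| < 2`. With the marked partitions `(Q, b) → G` encoded by the subsets `A` of the free
set of `G` (`RudnickSarnakRefine.lean`: `Q = refineBy G A`):

* `dens_refineBy` : `dens Q_A G u = ∏_{C : C ∩ A ≠ ∅} |u(C ∩ A)|`;
* `sum_powerset_moebius_mul_dens` : `∑_A μ(O, Q_A) dens Q_A G u = ∏_{C ∈ G} blockPoly G u C`
  (factorisation (4.25) via `partitionMoebius_refineBy` and distributivity);
* `density_identity` : for `u ∈ H_G`, `∑ |u_j| < 2`:
  `∑_A μ(O, Q_A) dens Q_A G u = ∑_{σ ∈ fib G} sign σ ∏_C blockFactor σ u C`.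

## References

* Z. Rudnick, P. Sarnak, Duke Math. J. 81 (1996), Props. 4.1–4.3, (4.23)–(4.30), Thm 4.1.
-/

noncomputable section

open Finset

namespace Literature.NumberTheory.LFunctions

namespace RudnickSarnak

variable {k : ℕ} (G : Finpartition (univ : Finset (Fin (k + 1))))

/-! ## The pairing density of `Q_A` -/

/-- **`dens Q_A G u = ∏_{C ∈ G, C ∩ A ≠ ∅} |u(C ∩ A)|`**: the new free representatives of `Q_A`
are the least elements of the nonempty `C ∩ A`, whose `Q_A`-blocks are the `C ∩ A`.
[cite: RudnickSarnak1996, proof of Prop 4.1] -/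
theorem dens_refineBy {A : Finset (Fin (k + 1))} (hA : A ⊆ freeSet G) (u : Fin (k + 1) → ℝ) :
    dens (refineBy G A) G u = ∏ C ∈ G.parts with (C ∩ A).Nonempty, |∑ i ∈ C ∩ A, u i| := by
  -- new free representatives lie in `A`, and their `Q_A`-block is `G.part j ∩ A`
  have hjA : ∀ j : NewFree (refineBy G A) G, j.1 ∈ A := by
    intro j
    by_contra h
    have h1 := (rep_refineBy_eq_rep_iff G hA j.1).2 h
    rw [j.2.1] at h1
    exact j.2.2 h1.symm
  have hpart : ∀ j : NewFree (refineBy G A) G, (refineBy G A).part j.1 = G.part j.1 ∩ A := by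
    intro j
    rw [part_refineBy_eq G (G.part_mem.2 (mem_univ _)) (G.mem_part_self.2 (mem_univ _)), if_pos (hjA j)]
  unfold dens
  refine Finset.prod_bij (fun j _ ↦ G.part j.1) ?_ ?_ ?_ ?_
  · intro j _
    exact Finset.mem_filter.2 ⟨G.part_mem.2 (mem_univ _), j.1,
      Finset.mem_inter.2 ⟨G.mem_part_self.2 (mem_univ _), hjA j⟩⟩
  · intro j _ j' _ h
    apply Subtype.ext
    have h1 : (refineBy G A).part j.1 = (refineBy G A).part j'.1 := by rw [hpart, hpart, h]
    have h2 := (part_eq_part_iff_rep_eq (refineBy G A)).1 h1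
    rwa [j.2.1, j'.2.1] at h2
  · intro C hC
    obtain ⟨hC, hne⟩ := Finset.mem_filter.1 hC
    obtain ⟨hjC, hjA'⟩ := Finset.mem_inter.1 (Finset.min'_mem _ hne)
    have hQpart : (refineBy G A).part ((C ∩ A).min' hne) = C ∩ A := by
      rw [part_refineBy_eq G hC hjC, if_pos hjA']
    refine ⟨⟨(C ∩ A).min' hne, ?_, fun hr ↦ (mem_freeSet G).1 (hA hjA') hr⟩, mem_univ _,
      G.part_eq_of_mem hC hjC⟩
    show rep (refineBy G A) ((C ∩ A).min' hne) = (C ∩ A).min' hne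
    unfold rep
    congr 1
  · intro j _
    rw [hpart]

/-! ## The factorised sieved pairing density -/

/-- The summand of the block polynomial indexed by a subset: `μ_C` for `∅`, else
`μ_B μ_{C∖B} |u(B)|`. [cite: RudnickSarnak1996, (4.24)–(4.26)] -/
def phiBlock (u : Fin (k + 1) → ℝ) (C B : Finset (Fin (k + 1))) : ℝ :=
  if B = ∅ then (blockMoebius C : ℝ) else ((blockMoebius B * blockMoebius (C \ B) : ℤ) : ℝ) * |∑ i ∈ B, u i|

/-- The free part of a block. [folklore] -/
theorem filter_not_isRep_eq_inter_freeSet (C : Finset (Fin (k + 1))) :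
    (C.filter fun a ↦ ¬IsRep G a) = C ∩ freeSet G := by
  ext a
  simp [mem_freeSet]

/-- The block polynomial as a sum over all subsets of the free part. [folklore] -/
theorem blockPoly_eq_sum_phiBlock (u : Fin (k + 1) → ℝ) (C : Finset (Fin (k + 1))) :
    blockPoly G u C = ∑ B ∈ (C ∩ freeSet G).powerset, phiBlock u C B := by
  rw [blockPoly, filter_not_isRep_eq_inter_freeSet,
    ← Finset.add_sum_erase _ _ (Finset.empty_mem_powerset (C ∩ freeSet G))]
  have h0 : phiBlock u C ∅ = (blockMoebius C : ℝ) := by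
    rw [phiBlock, if_pos rfl]
  have h1 : ((C ∩ freeSet G).powerset.erase ∅) = (C ∩ freeSet G).powerset.filter (·.Nonempty) := by
    ext B
    simp only [Finset.mem_erase, Finset.mem_filter, Finset.nonempty_iff_ne_empty]
    tauto
  rw [h0, h1, Finset.sum_congr rfl fun B hB ↦
    (show ((blockMoebius B * blockMoebius (C \ B) : ℤ) : ℝ) * |∑ i ∈ B, u i| = phiBlock u C B by
      rw [phiBlock, if_neg (Finset.nonempty_iff_ne_empty.1 (Finset.mem_filter.1 hB).2)])]

/-- The product of the `phiBlock (A ∩ C)` over the blocks is `μ(O, Q_A) · dens Q_A G u`.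
[cite: RudnickSarnak1996, (4.25)] -/
theorem prod_phiBlock_eq {A : Finset (Fin (k + 1))} (hA : A ⊆ freeSet G) (u : Fin (k + 1) → ℝ) :
    ∏ C ∈ G.parts, phiBlock u C (A ∩ C) =
      (partitionMoebius (refineBy G A) : ℝ) * dens (refineBy G A) G u := by
  rw [partitionMoebius_refineBy G hA, dens_refineBy G hA, Finset.prod_filter, Int.cast_prod,
    ← Finset.prod_mul_distrib]
  refine Finset.prod_congr rfl fun C _ ↦ ?_
  by_cases h : C ∩ A = ∅
  · have h' : A ∩ C = ∅ := by rw [Finset.inter_comm]; exact h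
    rw [if_pos h, if_neg (Finset.not_nonempty_iff_eq_empty.2 h), phiBlock, if_pos h', mul_one]
  · rw [if_neg h, if_pos (Finset.nonempty_iff_ne_empty.2 h), phiBlock, if_neg (by rwa [Finset.inter_comm]),
      Finset.inter_comm A C, Finset.sdiff_inter_self_left]

/-- **The sieved pairing density, factored over the blocks** (RS (4.23)–(4.26)):
`∑_{A ⊆ freeSet G} μ(O, Q_A) · dens Q_A G u = ∏_{C ∈ G} blockPoly G u C`.
[cite: RudnickSarnak1996, Prop 4.1, (4.23)–(4.26)] -/
theorem sum_powerset_moebius_mul_dens (u : Fin (k + 1) → ℝ) :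
    ∑ A ∈ (freeSet G).powerset, (partitionMoebius (refineBy G A) : ℝ) * dens (refineBy G A) G u =
      ∏ C ∈ G.parts, blockPoly G u C := by
  rw [Finset.prod_congr rfl fun C _ ↦ blockPoly_eq_sum_phiBlock G u C,
    prod_sum_powerset_eq_sum_powerset_prod G (phiBlock u)]
  refine Finset.sum_congr rfl fun A hA ↦ ?_
  rw [prod_phiBlock_eq G (Finset.mem_powerset.1 hA)]

/-- **The density identity on `H_G`** (Props. 4.1 and 4.3 combined, = Theorem 4.1 stratum by
stratum): for `u ∈ H_G` with `∑ |u_j| < 2`,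
`∑_{A ⊆ freeSet G} μ(O, Q_A) dens Q_A G u = ∑_{σ ∈ fib G} sign σ ∏_C blockFactor σ u C`.
[cite: RudnickSarnak1996, Thm 4.1, Props. 4.1–4.3] -/
theorem density_identity (u : Fin (k + 1) → ℝ) (hH : ∀ a, ∑ i ∈ G.part a, u i = 0)
    (hu : ∑ j, |u j| < 2) :
    ∑ A ∈ (freeSet G).powerset, (partitionMoebius (refineBy G A) : ℝ) * dens (refineBy G A) G u =
      ∑ σ ∈ fib G.parts, ((Equiv.Perm.sign σ : ℤ) : ℝ) * ∏ C ∈ G.parts, blockFactor σ u C := by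
  rw [sum_powerset_moebius_mul_dens, sum_sign_prod_blockFactor_eq_prod G u hH hu]

end RudnickSarnak

end Literature.NumberTheory.LFunctions

end
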